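import Summits.AtomisticToContinuum.HydrodynamicLimit.Theorems.JParityClosureParityRigidity
import HarnessLib

/-!
# Diagonal parity rigidity (stub S3c-b `stub_diagonalParityRigidity`, line `preshock-kinetic-slaving`,
# crux `JParityClosure.EvenStressEnskog`, stmt-AtomisticToContinuum-13079) — the L¹ defect of detailed balance

First step of every known route to the missing estimate of the diagonal rigidity (the diagonal collision
invariance of the limit pair law, antecedent of the landed reduction
`stub_diagonalParityRigidity_of_ae_map_collide_eq`): VANISHING EVEN ENTROPY PRODUCTION FORCES A VANISHING
`L¹` DEFECT OF DETAILED BALANCE.  With `R = e^{-F}` the ratio of post- to pre-collisional mollified pair densities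
and `Φ(F) = F (1 - e^{-F}) = (R - 1) log R ≥ 0` the production integrand,

* `two_mul_sq_exp_neg_half_sub_one_le` : `2 (√R - 1)² ≤ Φ` (from `log t ≤ t - 1`, `1 - t⁻¹ ≤ log t`);
* `abs_one_sub_exp_neg_le` : `|1 - R| ≤ Φ/2 + √(2Φ)` (pointwise);
* `tendsto_lintegral_mul_abs_one_sub_exp_neg` : for nonnegative weights `B_n` with `sup_n ∫ B_n dμ_n < ∞`,
  `∫ B_n Φ(F_n) dμ_n → 0 ⇒ ∫ B_n |1 - e^{-F_n}| dμ_n → 0` (Cauchy–Schwarz);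
* `tendsto_lintegral_hardSphereKernel_mul_abs_one_sub_exp_neg` : the instance for the objects of the stub —
  window laws `m_n` with bounded second moments, widths `ϑ_n`, `h_n = m_n ∗ G_{ϑ_n²}`, surprisal jump `F_n`, hard-sphere
  weight `B = ⟨w - v, ω⟩₊ ≤ 1 + ‖v‖² + ‖w‖²`: production `→ 0` ⇒ `∫∫ B |1 - e^{-F_n}| d(m_n ⊗ m_n) dω → 0`, i.e.
  `B · (T̂_ω)_#(ν_n ∗ G_n) / (ν_n ∗ G_n) → B` in `L¹(ν_n ⊗ dω)` (the form consumed by the coupling / energy arguments);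
* `stub_diagonalParityRigidity_defect` (registered sub-goal) : the same for `V3`, in the binder shape of the stub;
* `exists_integral_norm_sq_le_of_tendsto` : the stub's convergence of quadratic-growth statistics gives the bounded
  second moments used above.

References: C. Villani, *A review of mathematical topics in collisional kinetic theory* (2002) Ch. 2 §4 (entropy
production functionals); C. Cercignani, R. Illner, M. Pulvirenti (1994) §3.2.
-/

noncomputable section

open scoped BigOperators InnerProductSpace Topology ENNReal NNReal
open MeasureTheory Filter Set Metric Real
open Literature.MathematicalPhysics.KineticTheory Literature.Analysis.FluidPDE
open Summit.AtomisticToContinuum.HydrodynamicLimit.Theorems.ParityRigidity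

namespace Summit.AtomisticToContinuum.HydrodynamicLimit.Theorems.EvenStressEnskog

/-! ## Pointwise inequalities for `Φ(y) = y (1 - e^{-y})` -/

/-- `2 (e^{-y/2} - 1)² ≤ y (1 - e^{-y})`: the production integrand dominates twice the squared Hellinger-type
defect `(√R - 1)²`, `R = e^{-y}`. [folklore] -/
theorem two_mul_sq_exp_neg_half_sub_one_le (y : ℝ) :
    2 * (Real.exp (-y / 2) - 1) ^ 2 ≤ y * (1 - Real.exp (-y)) := by
  set t := Real.exp (-y / 2) with ht
  have ht0 : 0 < t := Real.exp_pos _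
  have hty : t ^ 2 = Real.exp (-y) := by
    rw [ht, ← Real.exp_nat_mul]
    congr 1
    push_cast
    ring
  rw [← hty]
  rcases le_or_gt 0 y with hy | hy
  · have h1 : 1 - t ≤ y / 2 := by
      have := Real.add_one_le_exp (-y / 2)
      rw [← ht] at this
      linarith
    have h2 : t ≤ 1 := by
      rw [ht]
      exact Real.exp_le_one_iff.2 (by linarith)
    nlinarith [mul_nonneg (sub_nonneg.2 h2) (by linarith : 0 ≤ y / 2 - (1 - t)),
      mul_nonneg (sub_nonneg.2 h2) (mul_nonneg hy ht0.le)]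
  · have ht1 : 1 < t := by
      rw [ht]
      exact Real.one_lt_exp_iff.2 (by linarith)
    have h3 : 1 - t⁻¹ ≤ -y / 2 := by
      have := Real.one_sub_inv_le_log_of_pos ht0
      rw [ht, Real.log_exp] at this
      rwa [ht]
    have h3' : t - 1 ≤ -y / 2 * t := by
      have := mul_le_mul_of_nonneg_right h3 ht0.le
      rwa [sub_mul, one_mul, inv_mul_cancel₀ ht0.ne'] at this
    nlinarith [mul_nonneg (sub_nonneg.2 ht1.le) (by linarith : 0 ≤ -y / 2 * t - (t - 1)),
      mul_nonneg (sub_nonneg.2 ht1.le) (by linarith : 0 ≤ -y)]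

/-- **Pointwise defect bound.** `|1 - e^{-y}| ≤ ½ y (1 - e^{-y}) + √(2 y (1 - e^{-y}))`. [folklore] -/
theorem abs_one_sub_exp_neg_le (y : ℝ) :
    |1 - Real.exp (-y)| ≤
      y * (1 - Real.exp (-y)) / 2 + Real.sqrt (2 * (y * (1 - Real.exp (-y)))) := by
  set Φ := y * (1 - Real.exp (-y)) with hΦ
  set s := Real.exp (-y / 2) - 1 with hs
  have hsΦ : 2 * s ^ 2 ≤ Φ := two_mul_sq_exp_neg_half_sub_one_le y
  have hexp : Real.exp (-y) = (s + 1) ^ 2 := by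
    rw [hs, sub_add_cancel, ← Real.exp_nat_mul]
    congr 1
    push_cast
    ring
  have h1 : |1 - Real.exp (-y)| ≤ s ^ 2 + 2 * |s| := by
    rw [hexp, show (1 : ℝ) - (s + 1) ^ 2 = -(s * (s + 2)) by ring, abs_neg, abs_mul]
    calc |s| * |s + 2| ≤ |s| * (|s| + 2) := by
          gcongr
          exact (abs_add_le s 2).trans (by norm_num)
      _ = s ^ 2 + 2 * |s| := by rw [mul_add, ← sq, sq_abs]; ring
  have h2 : s ^ 2 ≤ Φ / 2 := by linarith
  have h3 : |s| ≤ Real.sqrt (Φ / 2) := by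
    rw [← Real.sqrt_sq_eq_abs]
    exact Real.sqrt_le_sqrt h2
  have h4 : 2 * Real.sqrt (Φ / 2) = Real.sqrt (2 * Φ) := by
    rw [show (2 : ℝ) * Φ = 2 ^ 2 * (Φ / 2) by ring, Real.sqrt_mul (by norm_num), Real.sqrt_sq (by norm_num)]
  linarith

/-! ## Vanishing production forces a vanishing `L¹` defect -/

/-- **From entropy production to the `L¹` defect (abstract form).** For measures `μ_n`, nonnegative measurable
weights `B_n` with `∫ B_n dμ_n ≤ C < ∞`, and measurable `F_n`: if `∫ B_n F_n (1 - e^{-F_n}) dμ_n → 0` then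
`∫ B_n |1 - e^{-F_n}| dμ_n → 0` (pointwise bound `abs_one_sub_exp_neg_le` and Cauchy–Schwarz). [folklore] -/
theorem tendsto_lintegral_mul_abs_one_sub_exp_neg {X : Type*} [MeasurableSpace X] (μ : ℕ → Measure X)
    (B F : ℕ → X → ℝ) (hB0 : ∀ n x, 0 ≤ B n x) (hBm : ∀ n, Measurable (B n))
    (hFm : ∀ n, Measurable (F n)) {C : ℝ≥0∞} (hC : C ≠ ⊤)
    (hBC : ∀ n, ∫⁻ x, ENNReal.ofReal (B n x) ∂μ n ≤ C)
    (hP : Tendsto (fun n => ∫⁻ x, ENNReal.ofReal (B n x * (F n x * (1 - Real.exp (-F n x)))) ∂μ n)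
      atTop (𝓝 0)) :
    Tendsto (fun n => ∫⁻ x, ENNReal.ofReal (B n x * |1 - Real.exp (-F n x)|) ∂μ n) atTop (𝓝 0) := by
  set P : ℕ → ℝ≥0∞ := fun n =>
    ∫⁻ x, ENNReal.ofReal (B n x * (F n x * (1 - Real.exp (-F n x)))) ∂μ n with hPdef
  -- measurability
  have hΦm : ∀ n, Measurable fun x => B n x * (F n x * (1 - Real.exp (-F n x))) := fun n =>
    (hBm n).mul ((hFm n).mul (measurable_const.sub (hFm n).neg.exp))
  have hm0 : ∀ n, Measurable fun x => ENNReal.ofReal (B n x * (F n x * (1 - Real.exp (-F n x)))) :=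
    fun n => (hΦm n).ennreal_ofReal
  have hm1 : ∀ n, Measurable fun x => ENNReal.ofReal (Real.sqrt (B n x)) :=
    fun n => (hBm n).sqrt.ennreal_ofReal
  have hm2 : ∀ n, Measurable fun x =>
      ENNReal.ofReal (Real.sqrt (2 * (B n x * (F n x * (1 - Real.exp (-F n x)))))) :=
    fun n => ((hΦm n).const_mul 2).sqrt.ennreal_ofReal
  -- pointwise bound
  have hpt : ∀ n x, ENNReal.ofReal (B n x * |1 - Real.exp (-F n x)|) ≤
      ENNReal.ofReal (1 / 2) * ENNReal.ofReal (B n x * (F n x * (1 - Real.exp (-F n x)))) +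
        ENNReal.ofReal (Real.sqrt (B n x)) *
          ENNReal.ofReal (Real.sqrt (2 * (B n x * (F n x * (1 - Real.exp (-F n x)))))) := by
    intro n x
    have hb : 0 ≤ B n x := hB0 n x
    have hΦ : 0 ≤ F n x * (1 - Real.exp (-F n x)) :=
      le_trans (by positivity) (two_mul_sq_exp_neg_half_sub_one_le (F n x))
    have hbΦ : 0 ≤ B n x * (F n x * (1 - Real.exp (-F n x))) := mul_nonneg hb hΦ
    have key : B n x * |1 - Real.exp (-F n x)| ≤
        1 / 2 * (B n x * (F n x * (1 - Real.exp (-F n x)))) +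
          Real.sqrt (B n x) * Real.sqrt (2 * (B n x * (F n x * (1 - Real.exp (-F n x))))) := by
      have h := abs_one_sub_exp_neg_le (F n x)
      have hsq : Real.sqrt (B n x) * Real.sqrt (2 * (B n x * (F n x * (1 - Real.exp (-F n x))))) =
          B n x * Real.sqrt (2 * (F n x * (1 - Real.exp (-F n x)))) := by
        rw [show 2 * (B n x * (F n x * (1 - Real.exp (-F n x)))) =
            B n x * (2 * (F n x * (1 - Real.exp (-F n x)))) by ring,
          Real.sqrt_mul' _ (by positivity), ← mul_assoc, Real.mul_self_sqrt hb]
      rw [hsq]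
      calc B n x * |1 - Real.exp (-F n x)|
          ≤ B n x * (F n x * (1 - Real.exp (-F n x)) / 2 +
              Real.sqrt (2 * (F n x * (1 - Real.exp (-F n x))))) :=
            mul_le_mul_of_nonneg_left h hb
        _ = _ := by ring
    calc ENNReal.ofReal (B n x * |1 - Real.exp (-F n x)|)
        ≤ ENNReal.ofReal (1 / 2 * (B n x * (F n x * (1 - Real.exp (-F n x)))) +
            Real.sqrt (B n x) * Real.sqrt (2 * (B n x * (F n x * (1 - Real.exp (-F n x)))))) :=
          ENNReal.ofReal_le_ofReal key
      _ = _ := by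
          rw [ENNReal.ofReal_add (by positivity) (by positivity), ENNReal.ofReal_mul (by norm_num),
            ENNReal.ofReal_mul (Real.sqrt_nonneg _)]
  -- integrated bound
  have hbound : ∀ n, ∫⁻ x, ENNReal.ofReal (B n x * |1 - Real.exp (-F n x)|) ∂μ n ≤
      ENNReal.ofReal (1 / 2) * P n + C ^ (1 / 2 : ℝ) * (2 * P n) ^ (1 / 2 : ℝ) := by
    intro n
    have hCS : ∫⁻ x, ENNReal.ofReal (Real.sqrt (B n x)) *
        ENNReal.ofReal (Real.sqrt (2 * (B n x * (F n x * (1 - Real.exp (-F n x)))))) ∂μ n ≤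
        (∫⁻ x, ENNReal.ofReal (Real.sqrt (B n x)) ^ 2 ∂μ n) ^ (1 / 2 : ℝ) *
          (∫⁻ x, ENNReal.ofReal
            (Real.sqrt (2 * (B n x * (F n x * (1 - Real.exp (-F n x)))))) ^ 2 ∂μ n) ^ (1 / 2 : ℝ) := by
      have h := ENNReal.lintegral_mul_le_Lp_mul_Lq (μ n) Real.HolderConjugate.two_two
        (hm1 n).aemeasurable (hm2 n).aemeasurable
      simpa only [Pi.mul_apply, ENNReal.rpow_two] using h
    have hsq1 : ∫⁻ x, ENNReal.ofReal (Real.sqrt (B n x)) ^ 2 ∂μ n = ∫⁻ x, ENNReal.ofReal (B n x) ∂μ n := by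
      refine lintegral_congr fun x => ?_
      rw [← ENNReal.ofReal_pow (Real.sqrt_nonneg _), Real.sq_sqrt (hB0 n x)]
    have hsq2 : ∫⁻ x, ENNReal.ofReal
        (Real.sqrt (2 * (B n x * (F n x * (1 - Real.exp (-F n x)))))) ^ 2 ∂μ n = 2 * P n := by
      rw [hPdef, ← lintegral_const_mul _ (hm0 n)]
      refine lintegral_congr fun x => ?_
      rw [← ENNReal.ofReal_pow (Real.sqrt_nonneg _),
        Real.sq_sqrt (mul_nonneg (by norm_num) (mul_nonneg (hB0 n x)
          (le_trans (by positivity) (two_mul_sq_exp_neg_half_sub_one_le (F n x))))),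
        ENNReal.ofReal_mul (by norm_num : (0 : ℝ) ≤ 2), ENNReal.ofReal_ofNat]
    calc ∫⁻ x, ENNReal.ofReal (B n x * |1 - Real.exp (-F n x)|) ∂μ n
        ≤ ∫⁻ x, (ENNReal.ofReal (1 / 2) * ENNReal.ofReal (B n x * (F n x * (1 - Real.exp (-F n x)))) +
            ENNReal.ofReal (Real.sqrt (B n x)) *
              ENNReal.ofReal (Real.sqrt (2 * (B n x * (F n x * (1 - Real.exp (-F n x))))))) ∂μ n :=
          lintegral_mono (hpt n)
      _ = ENNReal.ofReal (1 / 2) * P n + ∫⁻ x, ENNReal.ofReal (Real.sqrt (B n x)) *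
            ENNReal.ofReal (Real.sqrt (2 * (B n x * (F n x * (1 - Real.exp (-F n x)))))) ∂μ n := by
          rw [lintegral_add_left ((hm0 n).const_mul _), lintegral_const_mul _ (hm0 n)]
      _ ≤ ENNReal.ofReal (1 / 2) * P n +
            (∫⁻ x, ENNReal.ofReal (B n x) ∂μ n) ^ (1 / 2 : ℝ) * (2 * P n) ^ (1 / 2 : ℝ) := by
          rw [← hsq1, ← hsq2]
          exact add_le_add le_rfl hCS
      _ ≤ ENNReal.ofReal (1 / 2) * P n + C ^ (1 / 2 : ℝ) * (2 * P n) ^ (1 / 2 : ℝ) := by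
          gcongr
          exact hBC n
  -- the bound tends to zero
  have hlim : Tendsto (fun n => ENNReal.ofReal (1 / 2) * P n + C ^ (1 / 2 : ℝ) * (2 * P n) ^ (1 / 2 : ℝ))
      atTop (𝓝 0) := by
    have h1 : Tendsto (fun n => ENNReal.ofReal (1 / 2) * P n) atTop (𝓝 (ENNReal.ofReal (1 / 2) * 0)) :=
      ENNReal.Tendsto.const_mul hP (Or.inr ENNReal.ofReal_ne_top)
    have h2 : Tendsto (fun n => 2 * P n) atTop (𝓝 (2 * 0)) :=
      ENNReal.Tendsto.const_mul hP (Or.inr ENNReal.ofNat_ne_top)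
    rw [mul_zero] at h1 h2
    have h3 : Tendsto (fun n => (2 * P n) ^ (1 / 2 : ℝ)) atTop (𝓝 0) := by
      have := ((ENNReal.continuous_rpow_const (y := (1 / 2 : ℝ))).tendsto 0).comp h2
      rwa [ENNReal.zero_rpow_of_pos (by norm_num : (0 : ℝ) < 1 / 2)] at this
    have h4 : Tendsto (fun n => C ^ (1 / 2 : ℝ) * (2 * P n) ^ (1 / 2 : ℝ)) atTop
        (𝓝 (C ^ (1 / 2 : ℝ) * 0)) :=
      ENNReal.Tendsto.const_mul h3 (Or.inr (ENNReal.rpow_ne_top_of_nonneg (by norm_num) hC))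
    rw [mul_zero] at h4
    simpa using h1.add h4
  exact tendsto_of_tendsto_of_tendsto_of_le_of_le tendsto_const_nhds hlim (fun _ => bot_le) hbound

/-! ## The instance for the objects of the stub -/

section Kinetic

variable {E : Type*} [NormedAddCommGroup E] [InnerProductSpace ℝ E] [FiniteDimensional ℝ E]
  [MeasurableSpace E] [BorelSpace E]

omit [FiniteDimensional ℝ E] [MeasurableSpace E] [BorelSpace E] in
/-- The hard-sphere weight of the production functional has quadratic growth:
`⟨w - v, ω⟩₊ ≤ 1 + ‖v‖² + ‖w‖²`. [folklore] -/
theorem hardSphereKernel_swap_le (p : E × E) (ω : sphere (0 : E) 1) :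
    hardSphereKernel (p.2, p.1) ω ≤ 1 + ‖p.1‖ ^ 2 + ‖p.2‖ ^ 2 := by
  unfold hardSphereKernel
  refine max_le ?_ (by positivity)
  calc ⟪p.2 - p.1, (ω : E)⟫_ℝ ≤ ‖p.2 - p.1‖ * ‖(ω : E)‖ := real_inner_le_norm _ _
    _ = ‖p.2 - p.1‖ := by rw [norm_eq_of_mem_sphere ω, mul_one]
    _ ≤ ‖p.2‖ + ‖p.1‖ := norm_sub_le _ _
    _ ≤ 1 + ‖p.1‖ ^ 2 + ‖p.2‖ ^ 2 := by
        nlinarith [sq_nonneg (‖p.1‖ - 1 / 2), sq_nonneg (‖p.2‖ - 1 / 2), norm_nonneg p.1, norm_nonneg p.2]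

/-- The total hard-sphere weight of a pair law with bounded second moments is bounded:
`∫∫ ⟨w - v, ω⟩₊ dω d(m ⊗ m) ≤ |S| (1 + 2 ∫ ‖v‖² dm)`. [folklore] -/
theorem lintegral_hardSphereKernel_prod_le (m : Measure E) [IsProbabilityMeasure m]
    (hm2 : Integrable (fun v => ‖v‖ ^ 2) m) {C : ℝ} (hC : ∫ v, ‖v‖ ^ 2 ∂m ≤ C) :
    ∫⁻ q, ENNReal.ofReal (hardSphereKernel (q.1.2, q.1.1) q.2)
        ∂((m.prod m).prod (sphereMeasure : Measure (sphere (0 : E) 1))) ≤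
      sphereMeasure (Set.univ : Set (sphere (0 : E) 1)) * (1 + 2 * ENNReal.ofReal C) := by
  haveI : IsFiniteMeasure (sphereMeasure : Measure (sphere (0 : E) 1)) := by
    unfold sphereMeasure; infer_instance
  have hsq : Measurable fun v : E => ENNReal.ofReal (‖v‖ ^ 2) :=
    (continuous_norm.pow 2).measurable.ennreal_ofReal
  have hsq1 : Measurable fun p : E × E => ENNReal.ofReal (‖p.1‖ ^ 2) :=
    (continuous_fst.norm.pow 2).measurable.ennreal_ofReal
  have hmom : ∫⁻ v, ENNReal.ofReal (‖v‖ ^ 2) ∂m ≤ ENNReal.ofReal C := by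
    rw [← ofReal_integral_eq_lintegral_ofReal hm2 (Eventually.of_forall fun v => by positivity)]
    exact ENNReal.ofReal_le_ofReal hC
  calc ∫⁻ q, ENNReal.ofReal (hardSphereKernel (q.1.2, q.1.1) q.2)
        ∂((m.prod m).prod (sphereMeasure : Measure (sphere (0 : E) 1)))
      ≤ ∫⁻ q, ENNReal.ofReal (1 + ‖q.1.1‖ ^ 2 + ‖q.1.2‖ ^ 2)
          ∂((m.prod m).prod (sphereMeasure : Measure (sphere (0 : E) 1))) :=
        lintegral_mono fun q => ENNReal.ofReal_le_ofReal (hardSphereKernel_swap_le q.1 q.2)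
    _ = ∫⁻ p, ∫⁻ _ω, ENNReal.ofReal (1 + ‖p.1‖ ^ 2 + ‖p.2‖ ^ 2) ∂(sphereMeasure : Measure (sphere (0 : E) 1))
          ∂(m.prod m) := by
        refine lintegral_prod _ (Measurable.aemeasurable ?_)
        exact (Continuous.measurable (by fun_prop)).ennreal_ofReal
    _ = sphereMeasure (Set.univ : Set (sphere (0 : E) 1)) *
          ∫⁻ p, ENNReal.ofReal (1 + ‖p.1‖ ^ 2 + ‖p.2‖ ^ 2) ∂(m.prod m) := by
        simp_rw [lintegral_const, mul_comm _ (sphereMeasure _)]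
        rw [lintegral_const_mul _ ((Continuous.measurable (by fun_prop)).ennreal_ofReal)]
    _ = sphereMeasure (Set.univ : Set (sphere (0 : E) 1)) *
          (1 + (∫⁻ p, ENNReal.ofReal (‖p.1‖ ^ 2) ∂(m.prod m) +
            ∫⁻ p, ENNReal.ofReal (‖p.2‖ ^ 2) ∂(m.prod m))) := by
        congr 1
        have hsplit : ∀ p : E × E, ENNReal.ofReal (1 + ‖p.1‖ ^ 2 + ‖p.2‖ ^ 2) =
            1 + (ENNReal.ofReal (‖p.1‖ ^ 2) + ENNReal.ofReal (‖p.2‖ ^ 2)) := by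
          intro p
          rw [add_assoc, ENNReal.ofReal_add (by norm_num) (by positivity), ENNReal.ofReal_one,
            ENNReal.ofReal_add (by positivity) (by positivity)]
        simp_rw [hsplit]
        rw [lintegral_add_left measurable_const, lintegral_const, measure_univ, mul_one,
          lintegral_add_left hsq1]
    _ = sphereMeasure (Set.univ : Set (sphere (0 : E) 1)) *
          (1 + (∫⁻ v, ENNReal.ofReal (‖v‖ ^ 2) ∂m + ∫⁻ v, ENNReal.ofReal (‖v‖ ^ 2) ∂m)) := by
        congr 3
        · have h := lintegral_prod_mul (μ := m) (ν := m) hsq.aemeasurable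
            (aemeasurable_const (b := (1 : ℝ≥0∞)))
          simp only [mul_one, lintegral_const, measure_univ] at h
          exact h
        · have h := lintegral_prod_mul (μ := m) (ν := m) (aemeasurable_const (b := (1 : ℝ≥0∞)))
            hsq.aemeasurable
          simp only [one_mul, lintegral_const, measure_univ] at h
          exact h
    _ ≤ sphereMeasure (Set.univ : Set (sphere (0 : E) 1)) * (1 + 2 * ENNReal.ofReal C) := by
        rw [two_mul]
        gcongr

/-- **The `L¹` defect of detailed balance vanishes along the diagonal.**  For window laws `m_n` (probability
measures with second moments bounded by `C`) and widths `ϑ_n`, with `h_n = m_n ∗ G_{ϑ_n²}` and the surprisal jump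
`F_n`, vanishing even entropy production `∫∫ B F_n (1 - e^{-F_n}) → 0` forces
`∫∫ B |1 - e^{-F_n}| dω d(m_n ⊗ m_n) → 0`. [folklore] -/
theorem tendsto_lintegral_hardSphereKernel_mul_abs_one_sub_exp_neg
    (ms : ℕ → Measure E) (hms : ∀ n, IsProbabilityMeasure (ms n)) (ϑs : ℕ → ℝ)
    (hms2 : ∀ n, Integrable (fun v : E => ‖v‖ ^ 2) (ms n)) {C : ℝ} (hC : ∀ n, ∫ v, ‖v‖ ^ 2 ∂(ms n) ≤ C)
    (hP : let h : ℕ → E → ℝ := fun n v => ∫ v', localMaxwellian 1 (ϑs n ^ 2) v v' ∂(ms n)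
      let F : ℕ → sphere (0 : E) 1 → E × E → ℝ := fun n ω p =>
        Real.log (h n p.1) + Real.log (h n p.2) - Real.log (h n (collide ω p).1) -
          Real.log (h n (collide ω p).2)
      Tendsto (fun n => ∫⁻ p, ∫⁻ ω, ENNReal.ofReal (hardSphereKernel (p.2, p.1) ω *
        (F n ω p * (1 - Real.exp (-F n ω p)))) ∂sphereMeasure ∂((ms n).prod (ms n))) atTop (𝓝 0)) :
    let h : ℕ → E → ℝ := fun n v => ∫ v', localMaxwellian 1 (ϑs n ^ 2) v v' ∂(ms n)
    let F : ℕ → sphere (0 : E) 1 → E × E → ℝ := fun n ω p =>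
      Real.log (h n p.1) + Real.log (h n p.2) - Real.log (h n (collide ω p).1) -
        Real.log (h n (collide ω p).2)
    Tendsto (fun n => ∫⁻ p, ∫⁻ ω, ENNReal.ofReal (hardSphereKernel (p.2, p.1) ω *
      |1 - Real.exp (-F n ω p)|) ∂sphereMeasure ∂((ms n).prod (ms n))) atTop (𝓝 0) := by
  intro h F
  replace hP : Tendsto (fun n => ∫⁻ p, ∫⁻ ω, ENNReal.ofReal (hardSphereKernel (p.2, p.1) ω *
      (F n ω p * (1 - Real.exp (-F n ω p)))) ∂sphereMeasure ∂((ms n).prod (ms n))) atTop (𝓝 0) := hP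
  haveI : IsFiniteMeasure (sphereMeasure : Measure (sphere (0 : E) 1)) := by
    unfold sphereMeasure; infer_instance
  -- measurability of the weight and of the surprisal jump on `(E × E) × S`
  have hB : Measurable fun q : (E × E) × sphere (0 : E) 1 => hardSphereKernel (q.1.2, q.1.1) q.2 := by
    refine Continuous.measurable ?_
    show Continuous fun q : (E × E) × sphere (0 : E) 1 => max ⟪q.1.2 - q.1.1, (q.2 : E)⟫_ℝ 0
    fun_prop
  have hc1 : Continuous fun q : (E × E) × sphere (0 : E) 1 => (collide q.2 q.1).1 := by
    show Continuous fun q : (E × E) × sphere (0 : E) 1 =>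
      q.1.1 - ⟪q.1.1 - q.1.2, (q.2 : E)⟫_ℝ • (q.2 : E)
    fun_prop
  have hc2 : Continuous fun q : (E × E) × sphere (0 : E) 1 => (collide q.2 q.1).2 := by
    show Continuous fun q : (E × E) × sphere (0 : E) 1 =>
      q.1.2 + ⟪q.1.1 - q.1.2, (q.2 : E)⟫_ℝ • (q.2 : E)
    fun_prop
  have hFm : ∀ n, Measurable fun q : (E × E) × sphere (0 : E) 1 => F n q.2 q.1 := by
    intro n
    have hhm : Measurable (h n) :=
      ParityRigidity.measurable_integral_localMaxwellian (ms n) (ϑs n)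
    exact (((hhm.comp measurable_fst.fst).log.add (hhm.comp measurable_fst.snd).log).sub
      (hhm.comp hc1.measurable).log).sub (hhm.comp hc2.measurable).log
  -- pass to the product measure `(m_n ⊗ m_n) ⊗ dω`
  set μ : ℕ → Measure ((E × E) × sphere (0 : E) 1) := fun n => ((ms n).prod (ms n)).prod sphereMeasure
    with hμ
  have hprod1 : ∀ n, ∫⁻ p, ∫⁻ ω, ENNReal.ofReal (hardSphereKernel (p.2, p.1) ω *
      (F n ω p * (1 - Real.exp (-F n ω p)))) ∂sphereMeasure ∂((ms n).prod (ms n)) =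
      ∫⁻ q, ENNReal.ofReal (hardSphereKernel (q.1.2, q.1.1) q.2 *
        (F n q.2 q.1 * (1 - Real.exp (-F n q.2 q.1)))) ∂μ n := fun n =>
    (lintegral_prod _ ((hB.mul ((hFm n).mul (measurable_const.sub
      (hFm n).neg.exp))).ennreal_ofReal).aemeasurable).symm
  have hprod2 : ∀ n, ∫⁻ p, ∫⁻ ω, ENNReal.ofReal (hardSphereKernel (p.2, p.1) ω *
      |1 - Real.exp (-F n ω p)|) ∂sphereMeasure ∂((ms n).prod (ms n)) =
      ∫⁻ q, ENNReal.ofReal (hardSphereKernel (q.1.2, q.1.1) q.2 *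
        |1 - Real.exp (-F n q.2 q.1)|) ∂μ n := fun n =>
    (lintegral_prod _ ((hB.mul ((measurable_const.sub
      (hFm n).neg.exp).abs)).ennreal_ofReal).aemeasurable).symm
  simp only [hprod1] at hP
  simp only [hprod2]
  refine tendsto_lintegral_mul_abs_one_sub_exp_neg μ
    (fun _ q => hardSphereKernel (q.1.2, q.1.1) q.2) (fun n q => F n q.2 q.1)
    (fun _ q => le_max_right _ _) (fun _ => hB) hFm
    (C := sphereMeasure (Set.univ : Set (sphere (0 : E) 1)) * (1 + 2 * ENNReal.ofReal C)) ?_ ?_ hP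
  · exact ENNReal.mul_ne_top (measure_ne_top _ _)
      (ENNReal.add_ne_top.2 ⟨ENNReal.one_ne_top, ENNReal.mul_ne_top ENNReal.ofNat_ne_top
        ENNReal.ofReal_ne_top⟩)
  · intro n
    haveI := hms n
    exact lintegral_hardSphereKernel_prod_le (ms n) (hms2 n) (hC n)

end Kinetic

/-- **Registered sub-goal (objects of the stub, `V3`).**  Along the diagonal of `stub_diagonalParityRigidity`
(window laws `m_n` with second moments `≤ C`, widths `ϑ_n`), vanishing even entropy production forces the
`L¹(m_n ⊗ m_n ⊗ dω)` defect of detailed balance `∫∫ ⟨w - v, ω⟩₊ |1 - e^{-F_n}|` to vanish. [folklore] -/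
theorem stub_diagonalParityRigidity_defect :
  ∀ (ms : ℕ → Measure V3) (ϑs : ℕ → ℝ) (C : ℝ),
    (∀ n, IsProbabilityMeasure (ms n)) →
    (∀ n, Integrable (fun v : V3 => ‖v‖ ^ 2) (ms n)) → (∀ n, ∫ v, ‖v‖ ^ 2 ∂(ms n) ≤ C) →
    (let h : ℕ → V3 → ℝ := fun n v => ∫ v', localMaxwellian 1 (ϑs n ^ 2) v v' ∂(ms n);
     let F : ℕ → Metric.sphere (0 : V3) 1 → V3 × V3 → ℝ := fun n ω p =>
       Real.log (h n p.1) + Real.log (h n p.2) - Real.log (h n (collide ω p).1) -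
         Real.log (h n (collide ω p).2);
     Tendsto (fun n => ∫⁻ p, ∫⁻ ω, ENNReal.ofReal (hardSphereKernel (p.2, p.1) ω *
        (F n ω p * (1 - Real.exp (-F n ω p)))) ∂sphereMeasure ∂((ms n).prod (ms n))) atTop (𝓝 0)) →
    (let h : ℕ → V3 → ℝ := fun n v => ∫ v', localMaxwellian 1 (ϑs n ^ 2) v v' ∂(ms n);
     let F : ℕ → Metric.sphere (0 : V3) 1 → V3 × V3 → ℝ := fun n ω p =>
       Real.log (h n p.1) + Real.log (h n p.2) - Real.log (h n (collide ω p).1) -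
         Real.log (h n (collide ω p).2);
     Tendsto (fun n => ∫⁻ p, ∫⁻ ω, ENNReal.ofReal (hardSphereKernel (p.2, p.1) ω *
        |1 - Real.exp (-F n ω p)|) ∂sphereMeasure ∂((ms n).prod (ms n))) atTop (𝓝 0)) :=
  fun ms ϑs _ hms hms2 hC hP =>
    tendsto_lintegral_hardSphereKernel_mul_abs_one_sub_exp_neg ms hms ϑs hms2 hC hP

/-- The stub's convergence of quadratic-growth statistics bounds the second moments of the window laws
uniformly. [folklore] -/
theorem exists_integral_norm_sq_le_of_tendsto (ms : ℕ → Measure V3) (m : Measure V3)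
    (hweak : ∀ G : V3 → ℝ, Continuous G → (∃ C : ℝ, ∀ v, |G v| ≤ C * (1 + ‖v‖ ^ 2)) →
      Tendsto (fun n => ∫ v, G v ∂(ms n)) atTop (𝓝 (∫ v, G v ∂m))) :
    ∃ C : ℝ, ∀ n, ∫ v, ‖v‖ ^ 2 ∂(ms n) ≤ C := by
  have ht := hweak (fun v => ‖v‖ ^ 2) (by fun_prop)
    ⟨1, fun v => by rw [abs_of_nonneg (by positivity)]; nlinarith [norm_nonneg v]⟩
  obtain ⟨C, hC⟩ := ht.bddAbove_range
  exact ⟨C, fun n => hC (Set.mem_range_self n)⟩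

end Summit.AtomisticToContinuum.HydrodynamicLimit.Theorems.EvenStressEnskog

end
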